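import Summits.Ventures.CertifiedManyBodySolver.Theorems.TcThermcert1Defs
import HarnessLib

/-!
# Route «hubbard-tc-thermcert-1», crux K2 `TcThermcert1.ThermalStiffnessCeilingBoxb10_le_9o71` (stmt-Ventures-26382), line «vertex»:
# the objects the line posits — the three thermal row WORDS as functions of `(U, μ₀)`, frozen multiplier data `CertDatum`, the
# frozen-dual Lagrangian `L_d(U, μ₀; ω)`, corner certificates on a `(U, μ₀)`-cell — and the line's statement `Prop`s

HONEST FRAMING: DEFINITIONS and statement `Prop`s only; nothing about the Hubbard model is proved in this file; no certificate and no
number lives here; KT ceilings never assert superconductivity; NO lower bound on `T_c` is claimed; no summit, rung or crux statement is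
proved. Cell `pub/hubbard-tc` (MO-S3 × D-0154 (1) thermcert-1), typed by seat `hubbard-tc-p1` (g28) on the cell lead's HANDOFF item
«plan-2's PROVED S3 `LagrAffineAll` to be landed `--supports stmt-Ventures-26382` by a prover» (RULING R128 (3)); the companion file
`Theorems/TcThermcert1VertexLagrAffine.lean` proves the registered stub `stub_lagr_affine : LagrAffineAll` over these objects.

These are, VERBATIM (namespace and docstrings apart), §2–§3 of the REGISTERED skeleton of line «vertex»
(`Cruxes/ThermalStiffnessCeilingBoxb10_le_9o71/Lines/vertex.lean`, hub-tc-therm-plan-2, sha16 135a6fd895490092; card `Lines/vertex.md`),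
plus the opener's K2 box-certificate statement `TrialGeneratorCertificateBoxB10` (hub-tc-therm-plan-1, `K2_birth.lean` v2 17ea93d255f5018b,
= hub-tc-therm-crit-2's STUB 3″ shape on the box) which the skeleton derives from S3 + S4. The shared §0/§1 objects (`trialWord`,
`IsTrialGenerator`, `InMuBand`, `IsThermalRowState`, `IsSupportingMu`, …) are imported from `Theorems/TcThermcert1Defs.lean`
(hubbard-thermal-p4, p614173) and are not re-declared. Everything here is line «vertex»-specific, hence the sub-namespace `.Vertex`
(as in `Theorems/TcThermcert1VertexStubTrialGeneratorHook.lean`).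

THE LINE'S IDEA (card `Lines/vertex.md`, for orientation): every row of `IsThermalRowState β t′ U n μ₀` — GC stationarity
`ω([K, Â]) = 0`, the `(s,q)`-linearised energy–entropy balance `β·ω(Âᴴ[K,Â]) − s·ω(ÂᴴÂ) + q·ω(ÂÂᴴ) ≥ 0`, the canonical Bogoliubov rows —
and the objective `W_a(U) = trialWord 0 U r a` are expectations of local words AFFINE in the pair `(U, μ₀)` (`K = H₀ + U·D − μ₀·N` enters
each word once). Hence for a FROZEN multiplier datum `d` the Lagrangian `L_d(U, μ₀; ω) = Re ω(W_a(U)) + Σ y·Re ω(row(U, μ₀))` is affine in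
`(U, μ₀)` for each state (stub S3, `LagrAffineAll`), dominates the objective on row states, and on a cell `[U₁,U₂] × [μ₁,μ₂]` is bounded by
its maximum over the four corners; a finite rational cell cover of the banded supporting set with four corner certificates per cell
(stub S4, `VertexCoverBoxB10`, the crux content) then certifies the whole box `U/t ∈ [7.9, 14.7]` at `β·t = 10`, `(n, t′) = (7/8, 0)` —
the `T > 0` transfer of the tree's `T = 0` corner rule `HubbardTTPrimeWindowCertificateConvexComb`.

WHAT THIS IS NOT: no certificate of any cell exists today (S4 is the producers' object); the composition S1 → S3 → S4 → K2 and the proved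
row admissibility live in the line file; this file changes nothing that provers are served.

References: DLS1978 §2 eqs. (22′), (27), (28); BratteliRobinsonII1997 Thm. 6.2.4; FawziFawziScalet2024 Thm. 3.1; WangEtAl2024 §III
(frozen-dual ∕ corner certificates); Han2020Bootstrap §2–3; ScalapinoWhiteZhang1993 §II.
-/

noncomputable section

namespace Summit.Ventures.CertifiedManyBodySolver.Theorems.TcThermcert1.Vertex

open Filter Topology Matrix Finset
open Literature.MathematicalPhysics.QuantumLattice
open Literature.MathematicalPhysics.QuantumLattice.ThermodynamicLimit
open Literature.MathematicalPhysics.QuantumFieldTheory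
open Literature.MathematicalPhysics.StatisticalMechanics
open Literature.Probability.LatticeModels
open Summit.Ventures.CertifiedManyBodySolver.Observables
open Summit.Ventures.CertifiedManyBodySolver.Theorems.TcThermcert1
open scoped ComplexConjugate ComplexOrder

/-! ## §1 The opener's K2 box-certificate statement (hub-tc-therm-plan-1 `K2_birth.lean` v2; the «vertex» skeleton DERIVES it from S3 + S4) -/

/-- The K2 box-certificate statement (byte-copy of the opener's `TrialGeneratorCertificateBoxB10`, v2 = hub-tc-therm-crit-2's reordered
STUB 3″ shape on the box): per `U` of the box `[79/10, 147/10]` and per banded SUPPORTING `μ₀`, SOME admissible local trial generator's word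
is `≤ 9/71` on all thermal row states at `(10; 0; U; 7/8; μ₀)`. In line «vertex» this is NOT a stub: it follows from `LagrAffineAll` and
`VertexCoverBoxB10` (`certificateBox_of_vertexCover` in the line file). Statement `Prop` of this route (no citation tag: it is
the line's object, not a published fact). -/
def TrialGeneratorCertificateBoxB10 : Prop :=
  ∀ U : ℝ, 79 / 10 ≤ U → U ≤ 147 / 10 → ∀ μ₀ : ℝ, InMuBand 10 1 0 U (7 / 8) μ₀ → IsSupportingMu 10 1 0 U (7 / 8) μ₀ →
    ∃ (r : ℕ) (a : FermionOp (box 2 r)), IsTrialGenerator r a ∧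
      ∀ ω : InfVolFermionState 2, IsThermalRowState 10 0 U (7 / 8) μ₀ ω →
        (ω.expect (box 2 (3 * r + 2)) (trialWord 0 U r a)).re ≤ (((9 / 71 : ℚ) : ℚ) : ℝ)

/-! ## §2 The line's objects: the three row words as functions of `(U, μ₀)`, frozen multiplier data, the Lagrangian, cells
(skeleton 135a6fd895490092 §2, verbatim) -/

/-- GC stationarity row word `K(U,μ₀) Â − Â K(U,μ₀)` on the window pair `Λ ⊆ Λ′` (shape VERBATIM `IsThermalRowState`, conjunct 3a).
[cite: BratteliRobinsonII1997, Thm. 6.2.4] -/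
def stWord (tp U μ₀ : ℝ) {Λ Λ' : Finset (Site 2)} (hΛ : Λ ⊆ Λ') (A : FermionOp Λ) : FermionOp Λ' :=
  gcLocalHamiltonianTT' Λ' 1 tp U μ₀ 0 * fermionEmbed (PolySite.incl hΛ) A -
    fermionEmbed (PolySite.incl hΛ) A * gcLocalHamiltonianTT' Λ' 1 tp U μ₀ 0

/-- `(s,q)`-linearised energy–entropy-balance row word `β·Âᴴ[K,Â] − s·ÂᴴÂ + q·ÂÂᴴ` (shape VERBATIM `IsThermalRowState`,
conjunct 3b). [cite: FawziFawziScalet2024, Thm. 3.1] -/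
def eebWord (β tp U μ₀ : ℝ) {Λ Λ' : Finset (Site 2)} (hΛ : Λ ⊆ Λ') (A : FermionOp Λ) (s q : ℝ) : FermionOp Λ' :=
  ((β : ℝ) : ℂ) • ((fermionEmbed (PolySite.incl hΛ) A)ᴴ *
      (gcLocalHamiltonianTT' Λ' 1 tp U μ₀ 0 * fermionEmbed (PolySite.incl hΛ) A -
        fermionEmbed (PolySite.incl hΛ) A * gcLocalHamiltonianTT' Λ' 1 tp U μ₀ 0)) -
    ((s : ℝ) : ℂ) • ((fermionEmbed (PolySite.incl hΛ) A)ᴴ * fermionEmbed (PolySite.incl hΛ) A) +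
    ((q : ℝ) : ℂ) • (fermionEmbed (PolySite.incl hΛ) A * (fermionEmbed (PolySite.incl hΛ) A)ᴴ)

/-- Canonical Bogoliubov row word (shape VERBATIM `IsThermalRowState`, conjunct 4). [cite: DLS1978, §2 eq. (28)] -/
def bogWord (β tp U : ℝ) {Λ Λ' : Finset (Site 2)} (hΛ : Λ ⊆ Λ') (A C : FermionOp Λ) : FermionOp Λ' :=
  fermionEmbed (PolySite.incl hΛ) A * (fermionEmbed (PolySite.incl hΛ) A)ᴴ +
      (fermionEmbed (PolySite.incl hΛ) A)ᴴ * fermionEmbed (PolySite.incl hΛ) A +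
      ((2 : ℝ) : ℂ) • (fermionEmbed (PolySite.incl hΛ) C * fermionEmbed (PolySite.incl hΛ) A -
        fermionEmbed (PolySite.incl hΛ) A * fermionEmbed (PolySite.incl hΛ) C) +
      ((β / 2 : ℝ) : ℂ) • ((fermionEmbed (PolySite.incl hΛ) C)ᴴ *
          ((hubbardTTPrimeFermionInteraction 1 tp U).localHamiltonian Λ' * fermionEmbed (PolySite.incl hΛ) C -
            fermionEmbed (PolySite.incl hΛ) C * (hubbardTTPrimeFermionInteraction 1 tp U).localHamiltonian Λ') -
        ((hubbardTTPrimeFermionInteraction 1 tp U).localHamiltonian Λ' * fermionEmbed (PolySite.incl hΛ) C -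
            fermionEmbed (PolySite.incl hΛ) C * (hubbardTTPrimeFermionInteraction 1 tp U).localHamiltonian Λ') *
          (fermionEmbed (PolySite.incl hΛ) C)ᴴ)

/-- A frozen stationarity row: window pair, generator, COMPLEX multiplier (equality row). [cite: WangEtAl2024, §III] -/
structure StRow where
  /-- The generator's window `Λ`. -/
  Λ : Finset (Site 2)
  /-- The row's window `Λ′ ⊇ Λ`. -/
  Λ' : Finset (Site 2)
  /-- `Λ ⊆ Λ′`. -/
  hΛ : Λ ⊆ Λ'
  /-- `Λ′` contains the `1`-thickening of `Λ` (so `K_{Λ′}` sees every term touching `Â`). -/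
  h8 : thicken Λ 1 ⊆ Λ'
  /-- The local generator `Â ∈ 𝔄_Λ`. -/
  A : FermionOp Λ
  /-- The frozen multiplier of this equality row. -/
  y : ℂ

/-- A frozen EEB row: window pair, generator, cut parameters `e^{s−1} ≤ q`, multiplier `y ≥ 0`. [cite: FawziFawziScalet2024, Thm. 3.1] -/
structure EebRow where
  /-- The generator's window `Λ`. -/
  Λ : Finset (Site 2)
  /-- The row's window `Λ′ ⊇ Λ`. -/
  Λ' : Finset (Site 2)
  /-- `Λ ⊆ Λ′`. -/
  hΛ : Λ ⊆ Λ'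
  /-- `Λ′` contains the `1`-thickening of `Λ`. -/
  h8 : thicken Λ 1 ⊆ Λ'
  /-- The local generator `Â ∈ 𝔄_Λ`. -/
  A : FermionOp Λ
  /-- Cut parameter `s`. -/
  s : ℝ
  /-- Cut parameter `q`. -/
  q : ℝ
  /-- The linearisation constraint `e^{s−1} ≤ q`. -/
  hsq : Real.exp (s - 1) ≤ q
  /-- The frozen multiplier of this inequality row. -/
  y : ℝ
  /-- Dual feasibility `0 ≤ y`. -/
  hy : 0 ≤ y

/-- A frozen canonical Bogoliubov row: window pair, gauge-invariant pair `(A, C)`, multiplier `y ≥ 0`. [cite: DLS1978, §2 eq. (28)] -/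
structure BogRow where
  /-- The generators' window `Λ`. -/
  Λ : Finset (Site 2)
  /-- The row's window `Λ′ ⊇ Λ`. -/
  Λ' : Finset (Site 2)
  /-- `Λ ⊆ Λ′`. -/
  hΛ : Λ ⊆ Λ'
  /-- `Λ′` contains the `1`-thickening of `Λ`. -/
  h8 : thicken Λ 1 ⊆ Λ'
  /-- The local operator `A ∈ 𝔄_Λ`. -/
  A : FermionOp Λ
  /-- The local operator `C ∈ 𝔄_Λ`. -/
  C : FermionOp Λ
  /-- `[A, N] = 0`. -/
  hAN : Commute A totalNumber
  /-- `[A, S^z] = 0`. -/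
  hAS : Commute A HubbardWave0.spinZ
  /-- `[C, N] = 0`. -/
  hCN : Commute C totalNumber
  /-- `[C, S^z] = 0`. -/
  hCS : Commute C HubbardWave0.spinZ
  /-- The frozen multiplier of this inequality row. -/
  y : ℝ
  /-- Dual feasibility `0 ≤ y`. -/
  hy : 0 ≤ y

/-- **A frozen certificate datum** for one `(U, μ₀)`-cell: an admissible local trial generator `a ∈ 𝔄_{[-r,r]²}` and finitely many
frozen rows of the three kinds. The multipliers do NOT depend on `(U, μ₀)`; only the row WORDS do (affinely). [cite: WangEtAl2024, §III] -/
structure CertDatum where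
  /-- Range of the trial generator. -/
  r : ℕ
  /-- The local trial generator `a ∈ 𝔄_{[-r,r]²}`. -/
  a : FermionOp (box 2 r)
  /-- Admissibility of `a` (Hermitian, even, conserving `N` and `S^z`). -/
  ha : IsTrialGenerator r a
  /-- The frozen stationarity rows. -/
  st : List StRow
  /-- The frozen energy–entropy-balance rows. -/
  eeb : List EebRow
  /-- The frozen canonical Bogoliubov rows. -/
  bog : List BogRow

/-- **The frozen-dual Lagrangian** at `(β; t, t′; n) = (10; 1, 0; 7/8)`:
`L_d(U, μ₀; ω) = Re ω(W_a(U)) + Σ_st Re(y·ω(st(U,μ₀))) + Σ_eeb y·Re ω(eeb(U,μ₀)) + Σ_bog y·Re ω(bog(U))`. [cite: WangEtAl2024, §III] -/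
def CertDatum.lagr (d : CertDatum) (U μ₀ : ℝ) (ω : InfVolFermionState 2) : ℝ :=
  (ω.expect (box 2 (3 * d.r + 2)) (trialWord 0 U d.r d.a)).re +
    (d.st.map fun ρ => (ρ.y * ω.expect ρ.Λ' (stWord 0 U μ₀ ρ.hΛ ρ.A)).re).sum +
    (d.eeb.map fun ρ => ρ.y * (ω.expect ρ.Λ' (eebWord 10 0 U μ₀ ρ.hΛ ρ.A ρ.s ρ.q)).re).sum +
    (d.bog.map fun ρ => ρ.y * (ω.expect ρ.Λ' (bogWord 10 0 U ρ.hΛ ρ.A ρ.C)).re).sum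

/-- **Corner certificates** of the datum `d` on the CELL `[U₁, U₂] × [μ₁, μ₂]` at level `c`: at each of the four corners `L_d ≤ c`
for EVERY translation-invariant state of density `7/8` (a `(U, μ₀)`-free superset of all thermal row states of the cell). Each
conjunct is ONE frozen-dual (SDP / relative-entropy) certificate with numeric data. [cite: WangEtAl2024, §III] -/
def CertDatum.RectCert (d : CertDatum) (U₁ U₂ μ₁ μ₂ c : ℝ) : Prop :=
  ∀ ω : InfVolFermionState 2, ω.IsTranslationInvariant → ω.density = 7 / 8 →
    d.lagr U₁ μ₁ ω ≤ c ∧ d.lagr U₁ μ₂ ω ≤ c ∧ d.lagr U₂ μ₁ ω ≤ c ∧ d.lagr U₂ μ₂ ω ≤ c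

/-- Joint affinity of the frozen-dual Lagrangian in `(U, μ₀)` along every line of the parameter plane. [cite: WangEtAl2024, §III] -/
def CertDatum.LagrAffine (d : CertDatum) : Prop :=
  ∀ (p₁ p₂ q₁ q₂ θ : ℝ) (ω : InfVolFermionState 2),
    d.lagr ((1 - θ) * p₁ + θ * q₁) ((1 - θ) * p₂ + θ * q₂) ω = (1 - θ) * d.lagr p₁ p₂ ω + θ * d.lagr q₁ q₂ ω

/-! ## §3 The line's two stub statements (skeleton 135a6fd895490092 §3, verbatim; registered on stmt-Ventures-26382 as
`stub_lagr_affine : LagrAffineAll` and `stub_vertexCover : VertexCoverBoxB10`) -/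

/-- STUB S3 statement of line «vertex»: every frozen-dual Lagrangian is jointly affine in `(U, μ₀)`. PROVED in the companion file
`Theorems/TcThermcert1VertexLagrAffine.lean` (`stub_lagr_affine`). Statement `Prop` of this route. -/
def LagrAffineAll : Prop := ∀ d : CertDatum, d.LagrAffine

/-- STUB S4 statement of line «vertex» (THE CRUX CONTENT of K2, finite and `(U, μ₀)`-free): a finite cover of the banded SUPPORTING
SET over the box `{(U, μ₀) : U ∈ [79/10, 147/10], μ₀ ∈ band(U), μ₀ supporting at U}` by rational cells `[U₁,U₂] × [μ₁,μ₂]`, each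
carrying ONE frozen certificate datum whose four corner certificates hold at level `9/71`. (Any certified enclosure of the supporting
set prunes the cells to be produced WITHOUT re-typing: the cover is only owed on band ∩ supporting set.) NOT proved anywhere today;
statement `Prop` of this route (the producers' object; frozen-dual ∕ corner certificates as in WangEtAl2024 §III, Han2020Bootstrap §2). -/
def VertexCoverBoxB10 : Prop :=
  ∃ S : Finset ((ℚ × ℚ) × (ℚ × ℚ)),
    (∀ U μ₀ : ℝ, 79 / 10 ≤ U → U ≤ 147 / 10 → InMuBand 10 1 0 U (7 / 8) μ₀ → IsSupportingMu 10 1 0 U (7 / 8) μ₀ →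
      ∃ c ∈ S, ((c.1.1 : ℚ) : ℝ) ≤ U ∧ U ≤ ((c.1.2 : ℚ) : ℝ) ∧ ((c.2.1 : ℚ) : ℝ) ≤ μ₀ ∧ μ₀ ≤ ((c.2.2 : ℚ) : ℝ)) ∧
      ∀ c ∈ S, ∃ d : CertDatum,
        d.RectCert ((c.1.1 : ℚ) : ℝ) ((c.1.2 : ℚ) : ℝ) ((c.2.1 : ℚ) : ℝ) ((c.2.2 : ℚ) : ℝ) (9 / 71)

end Summit.Ventures.CertifiedManyBodySolver.Theorems.TcThermcert1.Vertex

end
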